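import Mathlib.Geometry.Manifold.Instances.Sphere
import Mathlib.Analysis.Complex.Circle
import Mathlib.LinearAlgebra.Matrix.SpecialLinearGroup
import Mathlib.Geometry.Manifold.Diffeomorph
import Mathlib.Geometry.Manifold.SmoothEmbedding
import Mathlib.Geometry.Manifold.Algebra.LieGroup
import Literature.Topology.FourManifolds.ConnectedSum
import Literature.Topology.FourManifolds.MappingTorus
import HarnessLib

-- provenance: harness21/H21/H21/Prelude/FourManL/CircleSurgery.lean @ 6f25fb4 (interim HEAD d8f2665); M5 mechanical rewrite
/-!
# Surgery on a circle in a 4-manifold and Cappell–Shaneson spheres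
(trunk T-4MAN, prelude `FourManL`, outline `H21/Outlines/FourManL.md` §C10)

This file is the follow-up `CircleSurgery` requested by the `FourManM` prelude for **spc4.S18**
(Cappell–Shaneson homotopy spheres). It provides

* `Literature.ThreeTorus = Circle × Circle × Circle`, the 3-torus as a product Lie group (Mathlib:
  `LieGroup (𝓡 1) ω Circle`, `Prod.instLieGroup`), with model
  `𝓣 = (𝓡 1).prod ((𝓡 1).prod (𝓡 1))`; the monomial self-maps `Literature.torusMap A` of an integer
  matrix `A` (`z ↦ (∏ⱼ zⱼ ^ A₀ⱼ, ∏ⱼ zⱼ ^ A₁ⱼ, ∏ⱼ zⱼ ^ A₂ⱼ)`) and the diffeomorphism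
  `Literature.torusDiffeomorph A` for `A ∈ SL(3, ℤ)`.
* `Literature.IsOpenGluingWith IA IB IP R jA jB`: the body of `Literature.Topology.FourManifolds.IsOpenGluing` with the two open
  embeddings exposed, and `Literature.Topology.FourManifolds.isOpenGluing_iff`.
* Surgery on an embedded circle `c : 𝕊 1 → X` with trivial(ised) normal bundle in a manifold `X`
  (of dimension `4`): `Literature.CircleNbhd IX c` (a tubular neighbourhood `𝕊 1 × ℝ³ ↪ X`),
  `Literature.Topology.FourManifolds.discTimesSphere` (the new piece `D̊² × 𝕊 2`), the gluing relation `Literature.circleSurgeryRel ν`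
  and the relational predicate `Literature.IsCircleSurgery IX IP X P c` ("`P` is obtained from `X` by
  surgery on `c`, i.e. `P = (X ∖ ν(𝕊 1 × B³)) ∪ (D² × 𝕊 2)`").
* Cappell–Shaneson spheres: `Literature.IsCappellShanesonSphereOf A X` (`X` is obtained from the mapping
  torus of `torusDiffeomorph A`, `det (A - 1) = ±1`, by surgery on the section circle through the
  fixed point `1 ∈ T³`), `Literature.Topology.FourManifolds.IsCappellShanesonSphere`, the Akbulut–Kirby matrix and the
  Cappell–Shaneson family `cappellShanesonMatrix m`.

## Main statements (sorried, known results)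

* `Literature.Topology.FourManifolds.nonempty_circleNbhd`, `Literature.Topology.FourManifolds.exists_isCircleSurgery`, `Literature.Topology.FourManifolds.nonempty_diffeomorph_of_isCircleSurgery_of_eq`: surgery on
  an embedded circle in a closed orientable smooth 4-manifold exists and, for a fixed tubular neighbourhood,
  is unique up to diffeomorphism (Kosinski, *Differential Manifolds*, VI.1–2; Gompf–Stipsicz,
  *4-Manifolds and Kirby Calculus* (1999), §5.2).
* `Literature.Topology.FourManifolds.exists_isCappellShanesonSphereOf`: for `A ∈ SL(3, ℤ)` with `det (A - 1) = ±1` a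
  Cappell–Shaneson sphere exists as a closed smooth 4-manifold (Cappell–Shaneson 1976, §2).

## Mathlib status and design choices

* Mathlib has `Circle` with its Lie group structure, `Matrix.SpecialLinearGroup`, smooth
  embeddings and diffeomorphisms, but no tori as named manifolds, no surgery and no gluing
  (`rg -i 'surgery|torus' Mathlib/Geometry/Manifold`: only `AddCircle`/`Circle` instances).
  Gluings are the relational `Literature.Topology.FourManifolds.IsOpenGluing` of `FourManM.ConnectedSum` (outline Design 3).
* `circleSurgeryRel` is `FourManM`'s `Knot.TubularNbhd.glueRel` one dimension up, in the
  open-gluing form with the *same* radial parameter `t` on both sides: the annulus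
  `ν(u, t • v)` (`0 < t < 1`, `v ∈ 𝕊 2`) of `X ∖ c` is identified with `(t • u, v) ∈ D̊² × 𝕊 2`.
  The core `{0} × 𝕊 2` of the new piece is the limit `t → 0`: it caps off the boundary spheres
  `ν(𝕊 1 × t·𝕊 2)` as `t → 0`, while `t → 1` runs out into the untouched part of `X`
  (outline review #12d).
* The two framings of the normal bundle of `c` (`π₁ SO(3) = ℤ/2`) correspond to different
  `ν : CircleNbhd IX c`; `IsCircleSurgery` allows both (Cappell–Shaneson use both; Gompf 2010 §1).
* `IsCappellShanesonSphereOf` uses the explicit-witness form `IsOpenGluingWith` of the mapping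
  torus only to *name* the section circle `jA '' ({1} ×ˢ univ) ∪ jB '' ({1} ×ˢ univ)`; the bridge
  `IsCappellShanesonSphereOf.exists_isMappingTorusOf` to the accepted `IsMappingTorusOf` is proved
  (outline review #3).
* Real (proved) API: `torusMap_apply_one`, `torusMap_one`, `torusMap_mul`, `contMDiff_torusMap`
  (integer powers and finite products in the commutative Lie group `Circle`), `isOpenGluing_iff`,
  `CircleNbhd.isClosed_range_curve`, the determinant lemmas and `cappellShanesonMatrix_zero`.
* `exists_isCircleSurgery` assumes `X` orientable (`Literature.Topology.FourManifolds.IsOrientable`): only then is the normal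
  bundle of every embedded circle trivial, so that a `CircleNbhd` exists (`nonempty_circleNbhd`).

Sources: S. Cappell, J. Shaneson, *Some new four-manifolds*, Ann. of Math. 104 (1976), §§1–2;
S. Akbulut, R. Kirby, *A potential smooth counterexample in dimension 4 to the Poincaré conjecture,
the Schoenflies conjecture, and the Andrews–Curtis conjecture*, Topology 24 (1985), §1;
R. Gompf, *More Cappell–Shaneson spheres are standard*, Algebr. Geom. Topol. 10 (2010), §1;
R. Gompf, A. Stipsicz, *4-Manifolds and Kirby Calculus* (1999), §5.2; A. Kosinski, *Differential
Manifolds* (1993), VI.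
-/

open scoped Manifold ContDiff Topology
open Set

noncomputable section

namespace Literature.Topology.FourManifolds

/-- Local notation: `𝔼 n` is the model Euclidean space `EuclideanSpace ℝ (Fin n)`. -/
local notation "𝔼 " n:arg => EuclideanSpace ℝ (Fin n)

/-- Local notation: `𝕊 n` is the unit sphere in `EuclideanSpace ℝ (Fin (n + 1))`. -/
local notation "𝕊 " n:arg => (Metric.sphere (0 : EuclideanSpace ℝ (Fin (n + 1))) 1)

/-- Local notation: the model with corners `𝓣 = (𝓡 1).prod ((𝓡 1).prod (𝓡 1))` of `ThreeTorus`. -/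
local notation "𝓣" =>
  (ModelWithCorners.prod (𝓡 1) (ModelWithCorners.prod (𝓡 1) (𝓡 1)))

/-! ### The 3-torus and its `SL(3, ℤ)` automorphisms -/

section Torus

/-- The **3-torus** `T³ = 𝕊¹ × 𝕊¹ × 𝕊¹` as a product of three copies of Mathlib's `Circle`; it
inherits the product charted space structure on `ModelProd (𝔼 1) (ModelProd (𝔼 1) (𝔼 1))`, the
manifold structure for `(𝓡 1).prod ((𝓡 1).prod (𝓡 1))` and the product (commutative) Lie group
structure (Cappell–Shaneson 1976, §2). [cite: CappellShaneson1976, §2] -/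
abbrev ThreeTorus : Type := Circle × Circle × Circle

/-- The three circle coordinates `(z₀, z₁, z₂)` of a point of `T³`, as a function `Fin 3 → Circle`
(Cappell–Shaneson 1976, §2). [cite: CappellShaneson1976, §2] -/
def torusCoord (z : ThreeTorus) : Fin 3 → Circle := ![z.1, z.2.1, z.2.2]

/-- The `0`-th coordinate of `T³` is the first factor. [folklore] -/
@[simp] theorem torusCoord_zero (z : ThreeTorus) : torusCoord z 0 = z.1 := rfl
/-- The `1`-st coordinate of `T³` is the second factor. [folklore] -/
@[simp] theorem torusCoord_one (z : ThreeTorus) : torusCoord z 1 = z.2.1 := rfl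
/-- The `2`-nd coordinate of `T³` is the third factor. [folklore] -/
@[simp] theorem torusCoord_two (z : ThreeTorus) : torusCoord z 2 = z.2.2 := rfl

/-- The coordinates of `1 ∈ T³` are all `1`. [folklore] -/
@[simp] theorem torusCoord_one' : torusCoord 1 = 1 := by
  ext i; fin_cases i <;> rfl

/-- The **monomial** `z ↦ ∏ⱼ zⱼ ^ rⱼ : T³ → 𝕊¹` of an integer row vector `r`
(Cappell–Shaneson 1976, §2). [cite: CappellShaneson1976, §2] -/
def torusMonomial (r : Fin 3 → ℤ) (z : ThreeTorus) : Circle := ∏ j, torusCoord z j ^ r j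

/-- The **linear self-map of the 3-torus** defined by an integer matrix `A`: in multiplicative
coordinates `z = (z₀, z₁, z₂)`, `torusMap A z = (∏ⱼ zⱼ ^ A₀ⱼ, ∏ⱼ zⱼ ^ A₁ⱼ, ∏ⱼ zⱼ ^ A₂ⱼ)`, i.e. the
map `ℝ³/ℤ³ → ℝ³/ℤ³` induced by `A` (Cappell–Shaneson 1976, §2; Akbulut–Kirby 1985, §1). [cite: CappellShaneson1976, §2] -/
def torusMap (A : Matrix (Fin 3) (Fin 3) ℤ) : ThreeTorus → ThreeTorus := fun z ↦
  (torusMonomial (A 0) z, torusMonomial (A 1) z, torusMonomial (A 2) z)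

/-- The coordinates of `torusMap A z` are the monomials of the rows of `A`. [folklore] -/
@[simp] theorem torusCoord_torusMap (A : Matrix (Fin 3) (Fin 3) ℤ) (z : ThreeTorus) (i : Fin 3) :
    torusCoord (torusMap A z) i = torusMonomial (A i) z := by
  fin_cases i <;> rfl

/-- Two points of `T³` with the same coordinates are equal. [folklore] -/
theorem torusCoord_injective : Function.Injective torusCoord := by
  rintro ⟨a, b, c⟩ ⟨a', b', c'⟩ h
  have h0 := congr_fun h 0
  have h1 := congr_fun h 1
  have h2 := congr_fun h 2
  simp only [torusCoord_zero, torusCoord_one, torusCoord_two] at h0 h1 h2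
  rw [h0, h1, h2]

/-- `torusMap A` fixes the identity element `1 ∈ T³` (the base point of the section circle of the
Cappell–Shaneson construction; Cappell–Shaneson 1976, §2). [cite: CappellShaneson1976, §2] -/
@[simp] theorem torusMap_apply_one (A : Matrix (Fin 3) (Fin 3) ℤ) : torusMap A 1 = 1 := by
  apply torusCoord_injective
  ext i
  simp [torusMonomial]

/-- The identity matrix acts as the identity of `T³`. [folklore] -/
@[simp] theorem torusMap_one : torusMap 1 = id := by
  funext z
  apply torusCoord_injective
  ext i
  simp [torusMonomial, Matrix.one_apply]

/-- In a commutative group, `∏ᵢ a ^ fᵢ = a ^ ∑ᵢ fᵢ` for integer exponents (the `zpow` analogue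
of `Finset.prod_pow_eq_pow_sum`). [folklore] -/
theorem prod_zpow_eq_zpow_sum {ι G : Type*} [CommGroup G] (s : Finset ι) (f : ι → ℤ) (a : G) :
    ∏ i ∈ s, a ^ f i = a ^ ∑ i ∈ s, f i :=
  Finset.cons_induction (by simp)
    (fun _ _ _ h ↦ by simp [Finset.prod_cons, Finset.sum_cons, zpow_add, h]) s

/-- A monomial of `torusMap B z` is a monomial of `z`, with exponent row `r ᵥ* B`. [folklore] -/
theorem torusMonomial_torusMap (r : Fin 3 → ℤ) (B : Matrix (Fin 3) (Fin 3) ℤ) (z : ThreeTorus) :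
    torusMonomial r (torusMap B z) = torusMonomial (Matrix.vecMul r B) z := by
  simp only [torusMonomial, torusCoord_torusMap, Matrix.vecMul, dotProduct]
  simp_rw [← prod_zpow_eq_zpow_sum, ← Finset.prod_zpow, ← zpow_mul]
  rw [Finset.prod_comm]
  simp_rw [mul_comm]

/-- `A ↦ torusMap A` is multiplicative: `torusMap (A * B) = torusMap A ∘ torusMap B`
(so `SL(3, ℤ)` acts on `T³`; Cappell–Shaneson 1976, §2). [cite: CappellShaneson1976, §2] -/
theorem torusMap_mul (A B : Matrix (Fin 3) (Fin 3) ℤ) :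
    torusMap (A * B) = torusMap A ∘ torusMap B := by
  funext z
  apply torusCoord_injective
  ext i : 1
  simp only [Function.comp_apply, torusCoord_torusMap, torusMonomial_torusMap]
  rfl

/-- Integer powers `z ↦ z ^ m` are smooth on the Lie group `Circle`. [folklore] -/
theorem contMDiff_circle_zpow (m : ℤ) : ContMDiff (𝓡 1) (𝓡 1) ∞ fun z : Circle ↦ z ^ m := by
  cases m with
  | ofNat n => simpa only [Int.ofNat_eq_natCast, zpow_natCast] using contMDiff_pow n
  | negSucc n => simpa only [zpow_negSucc] using (contMDiff_pow (n + 1)).inv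

/-- Each circle coordinate `T³ → 𝕊¹` is smooth. [folklore] -/
theorem contMDiff_torusCoord (j : Fin 3) : ContMDiff 𝓣 (𝓡 1) ∞ fun z : ThreeTorus ↦ torusCoord z j := by
  fin_cases j
  · exact contMDiff_fst
  · exact contMDiff_fst.comp contMDiff_snd
  · exact contMDiff_snd.comp contMDiff_snd

/-- Monomials `T³ → 𝕊¹` are smooth (products of integer powers in a commutative Lie group). [folklore] -/
theorem contMDiff_torusMonomial (r : Fin 3 → ℤ) : ContMDiff 𝓣 (𝓡 1) ∞ (torusMonomial r) := by
  unfold torusMonomial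
  exact ContMDiff.prod fun j _ ↦ (contMDiff_circle_zpow (r j)).comp (contMDiff_torusCoord j)

/-- **Linear torus maps are smooth**: `torusMap A : T³ → T³` is `C^∞` (each coordinate is a
monomial in a commutative Lie group; Cappell–Shaneson 1976, §2). [cite: CappellShaneson1976, §2] -/
theorem contMDiff_torusMap (A : Matrix (Fin 3) (Fin 3) ℤ) : ContMDiff 𝓣 𝓣 ∞ (torusMap A) :=
  (contMDiff_torusMonomial (A 0)).prodMk
    ((contMDiff_torusMonomial (A 1)).prodMk (contMDiff_torusMonomial (A 2)))

/-- **The diffeomorphism of `T³` defined by `A ∈ SL(3, ℤ)`**, with inverse `torusMap ↑A⁻¹`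
(Cappell–Shaneson 1976, §2; Akbulut–Kirby 1985, §1). Relies on: `contMDiff_torusMap` (proved). [cite: CappellShaneson1976, §2] -/
def torusDiffeomorph (A : Matrix.SpecialLinearGroup (Fin 3) ℤ) :
    ThreeTorus ≃ₘ⟮𝓣, 𝓣⟯ ThreeTorus where
  toFun := torusMap (A : Matrix (Fin 3) (Fin 3) ℤ)
  invFun := torusMap ((A⁻¹ : Matrix.SpecialLinearGroup (Fin 3) ℤ) : Matrix (Fin 3) (Fin 3) ℤ)
  left_inv z := by
    change (torusMap _ ∘ torusMap _) z = z
    rw [← torusMap_mul, ← Matrix.SpecialLinearGroup.coe_mul, inv_mul_cancel,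
      Matrix.SpecialLinearGroup.coe_one, torusMap_one, id]
  right_inv z := by
    change (torusMap _ ∘ torusMap _) z = z
    rw [← torusMap_mul, ← Matrix.SpecialLinearGroup.coe_mul, mul_inv_cancel,
      Matrix.SpecialLinearGroup.coe_one, torusMap_one, id]
  contMDiff_toFun := contMDiff_torusMap _
  contMDiff_invFun := contMDiff_torusMap _

/-- The underlying map of `torusDiffeomorph A` is `torusMap ↑A`. [folklore] -/
@[simp] theorem coe_torusDiffeomorph (A : Matrix.SpecialLinearGroup (Fin 3) ℤ) :
    ⇑(torusDiffeomorph A) = torusMap (A : Matrix (Fin 3) (Fin 3) ℤ) := rfl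

/-- `torusDiffeomorph A` fixes `1 ∈ T³`. [folklore] -/
@[simp] theorem torusDiffeomorph_apply_one (A : Matrix.SpecialLinearGroup (Fin 3) ℤ) :
    torusDiffeomorph A 1 = 1 :=
  torusMap_apply_one _

end Torus

/-! ### Open gluings with explicit witnesses -/

section Gluing

variable {EA HA EB HB EP HP : Type*}
  [NormedAddCommGroup EA] [NormedSpace ℝ EA] [TopologicalSpace HA] (IA : ModelWithCorners ℝ EA HA)
  [NormedAddCommGroup EB] [NormedSpace ℝ EB] [TopologicalSpace HB] (IB : ModelWithCorners ℝ EB HB)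
  [NormedAddCommGroup EP] [NormedSpace ℝ EP] [TopologicalSpace HP] (IP : ModelWithCorners ℝ EP HP)
  {A B P : Type*} [TopologicalSpace A] [ChartedSpace HA A] [TopologicalSpace B]
  [ChartedSpace HB B] [TopologicalSpace P] [ChartedSpace HP P]

/-- **Open gluing with explicit gluing maps.** `IsOpenGluingWith IA IB IP R jA jB` is the body of
`Literature.IsOpenGluing IA IB IP R` with the witnesses exposed: `jA : A → P` and `jB : B → P` are `C^∞`
embeddings with open ranges covering `P`, and `jA a = jB b ↔ R a b`. It is used when a further
construction has to refer to the images `jA`, `jB` (e.g. to name a circle in a mapping torus)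
(Kervaire–Milnor, *Groups of homotopy spheres I* (1963), §2; Kosinski, *Differential Manifolds*,
VI.1; outline `FourManM` Design 3, `FourManL` C10). [folklore] -/
def IsOpenGluingWith (R : A → B → Prop) (jA : A → P) (jB : B → P) : Prop :=
  Manifold.IsSmoothEmbedding IA IP ∞ jA ∧ IsOpen (range jA) ∧
    Manifold.IsSmoothEmbedding IB IP ∞ jB ∧ IsOpen (range jB) ∧
    range jA ∪ range jB = univ ∧ ∀ a b, jA a = jB b ↔ R a b

variable {IA IB IP}

/-- `IsOpenGluing` is `IsOpenGluingWith` for some gluing maps (by definition). [folklore] -/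
theorem isOpenGluing_iff {R : A → B → Prop} :
    IsOpenGluing IA IB IP (P := P) R ↔ ∃ jA jB, IsOpenGluingWith IA IB IP (P := P) R jA jB :=
  Iff.rfl

/-- Forgetting the witnesses of an `IsOpenGluingWith`. [folklore] -/
theorem IsOpenGluingWith.isOpenGluing {R : A → B → Prop} {jA : A → P} {jB : B → P}
    (h : IsOpenGluingWith IA IB IP R jA jB) : IsOpenGluing IA IB IP (P := P) R :=
  ⟨jA, jB, h⟩

end Gluing

/-! ### Surgery on an embedded circle -/

section CircleSurgery

variable {EX HX : Type*} [NormedAddCommGroup EX] [NormedSpace ℝ EX] [TopologicalSpace HX]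
  (IX : ModelWithCorners ℝ EX HX) {X : Type*} [TopologicalSpace X] [ChartedSpace HX X]

/-- A **(trivialised, open) tubular neighbourhood of an embedded circle** `c : 𝕊 1 → X` in a
manifold `X` modelled on `IX` (of dimension `4` in all applications): a `C^∞` open embedding
`𝕊 1 × ℝ³ ↪ X` whose zero section is `c`. Its existence for a smoothly embedded circle in an
orientable 4-manifold is the tubular neighbourhood theorem plus triviality of orientable rank-3
bundles over `𝕊 1`; the two homotopy classes of trivialisations (`π₁ SO(3) = ℤ/2`) give the two
possible framings of the surgery (Kosinski, *Differential Manifolds*, VI.2; Gompf–Stipsicz (1999),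
§5.2; Cappell–Shaneson 1976, §2). [cite: GompfStipsicz1999] -/
structure CircleNbhd (c : 𝕊 1 → X) where
  /-- The embedding `𝕊 1 × ℝ³ → X`. -/
  toFun : (𝕊 1) × (𝔼 3) → X
  /-- The map is a `C^∞` embedding. -/
  isSmoothEmbedding : Manifold.IsSmoothEmbedding ((𝓡 1).prod 𝓘(ℝ, 𝔼 3)) IX ∞ toFun
  /-- The image is open (so `toFun` is an open embedding of a codimension-`0` piece). -/
  isOpen_range : IsOpen (Set.range toFun)
  /-- The zero section is the circle `c`. -/
  apply_zero : ∀ u, toFun (u, 0) = c u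

namespace CircleNbhd

variable {IX} {c : 𝕊 1 → X} (ν : CircleNbhd IX c)

/-- The tubular neighbourhood map is continuous. [folklore] -/
theorem continuous : Continuous ν.toFun :=
  ν.isSmoothEmbedding.isEmbedding.continuous

/-- The core circle `c = ν ∘ (·, 0)` of a tubular neighbourhood is continuous. [folklore] -/
theorem continuous_curve (ν : CircleNbhd IX c) : Continuous c := by
  have : c = ν.toFun ∘ fun u ↦ (u, 0) := funext fun u ↦ (ν.apply_zero u).symm
  rw [this]
  exact ν.continuous.comp (by fun_prop)

/-- The image of the core circle is closed (a continuous image of the compact space `𝕊 1` in the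
Hausdorff space `X`), so that its complement is an open submanifold of `X`. [folklore] -/
theorem isClosed_range_curve [T2Space X] (ν : CircleNbhd IX c) : IsClosed (Set.range c) :=
  (isCompact_range ν.continuous_curve).isClosed

/-- The **complement of the core circle** `X ∖ c(𝕊 1)` as an open subset of `X` (hence a manifold
with Mathlib's open-submanifold structure); the first piece of the surgery gluing
(Gompf–Stipsicz (1999), §5.2). [cite: GompfStipsicz1999] -/
def complement [T2Space X] (ν : CircleNbhd IX c) : TopologicalSpace.Opens X :=
  ⟨(Set.range c)ᶜ, ν.isClosed_range_curve.isOpen_compl⟩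

/-- Membership in `ν.complement` is non-membership in the range of the core circle. [folklore] -/
@[simp] theorem mem_complement_iff [T2Space X] (x : X) : x ∈ ν.complement ↔ x ∉ Set.range c :=
  Iff.rfl

end CircleNbhd

/-- The **new piece `D̊² × 𝕊 2` of circle surgery**: the open subset `{(w, v) | ‖w‖ < 1}` of
`ℝ² × 𝕊 2`, an open submanifold for the model `𝓘(ℝ, 𝔼 2).prod (𝓡 2)` (Gompf–Stipsicz (1999),
§5.2; Cappell–Shaneson 1976, §2). [cite: GompfStipsicz1999] -/
def discTimesSphere : TopologicalSpace.Opens ((𝔼 2) × (𝕊 2)) :=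
  ⟨{p | ‖p.1‖ < 1}, isOpen_lt (continuous_norm.comp continuous_fst) continuous_const⟩

/-- Membership in `discTimesSphere`, definitionally. [folklore] -/
@[simp] theorem mem_discTimesSphere_iff (p : (𝔼 2) × (𝕊 2)) : p ∈ discTimesSphere ↔ ‖p.1‖ < 1 :=
  Iff.rfl

variable {IX} in
/-- The **circle surgery gluing relation.** Given a tubular neighbourhood `ν : 𝕊 1 × ℝ³ ↪ X` of the
circle `c`, the point `a` of `X ∖ c(𝕊 1)` is identified with the point `b = (w, v)` of `D̊² × 𝕊 2`
iff `w = t • u` and `a = ν (u, t • v)` for some `u ∈ 𝕊 1` and `0 < t < 1`. Thus the punctured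
open tube `ν(𝕊 1 × (B³ ∖ 0)) ≅ 𝕊 1 × (0, 1) × 𝕊 2` is identified with
`(D̊² ∖ 0) × 𝕊 2 ≅ 𝕊 1 × (0, 1) × 𝕊 2` by the identity in the coordinates `(u, t, v)`, with the
*same* radial parameter `t` on both sides (the open-gluing form of `Knot.TubularNbhd.glueRel`, one
dimension up). The core `{0} × 𝕊 2` of the new piece is the limit `t → 0`: the meridian discs
`{t • u | t < 1} × {v}` cap off the boundary spheres `ν(𝕊 1 × t·𝕊 2)` as `t → 0` (each parallel
circle `ν(𝕊 1 × {t • v})` bounds a disc in the new piece), while `t → 1` runs out into the untouched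
part `X ∖ ν(𝕊 1 × B³)`. The result is `(X ∖ ν(𝕊 1 × B³)) ∪_{𝕊 1 × 𝕊 2} (D² × 𝕊 2)`: `𝕊 1 × B³` is
replaced by `D² × 𝕊 2` (Gompf–Stipsicz (1999), §5.2; Cappell–Shaneson 1976, §2; outline C10,
review #12d). [cite: GompfStipsicz1999] -/
def circleSurgeryRel {c : 𝕊 1 → X} (ν : CircleNbhd IX c) (a : ↥(Set.range c)ᶜ)
    (b : ↥discTimesSphere) : Prop :=
  ∃ (u : 𝕊 1) (t : ℝ), t ∈ Set.Ioo (0 : ℝ) 1 ∧ (b : (𝔼 2) × (𝕊 2)).1 = t • (u : 𝔼 2) ∧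
    (a : X) = ν.toFun (u, t • ((b : (𝔼 2) × (𝕊 2)).2 : 𝔼 3))

end CircleSurgery

section IsCircleSurgery

variable {EX HX : Type*} [NormedAddCommGroup EX] [NormedSpace ℝ EX] [TopologicalSpace HX]
  (IX : ModelWithCorners ℝ EX HX)
  {EP HP : Type*} [NormedAddCommGroup EP] [NormedSpace ℝ EP] [TopologicalSpace HP]
  (IP : ModelWithCorners ℝ EP HP) (X P : Type*) [TopologicalSpace X] [ChartedSpace HX X]
  [TopologicalSpace P] [ChartedSpace HP P]

/-- **Surgery on an embedded circle** (relational form). `IsCircleSurgery IX IP X P c` says that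
the manifold `P` (modelled on `IP`) is obtained from `X` by surgery on the circle `c : 𝕊 1 → X`:
for some tubular neighbourhood `ν : 𝕊 1 × ℝ³ ↪ X` of `c`, `P` is the open gluing
(`Literature.Topology.FourManifolds.IsOpenGluing`) of `X ∖ c(𝕊 1)` and `D̊² × 𝕊 2` along `circleSurgeryRel ν`, i.e.
`P ≅ (X ∖ ν(𝕊 1 × B³)) ∪_{𝕊 1 × 𝕊 2} (D² × 𝕊 2)`. The two framings of the normal bundle
(`π₁ SO(3) = ℤ/2`) correspond to different `ν` and are both allowed; in general they give different
manifolds `P` (Gompf–Stipsicz (1999), §5.2; Cappell–Shaneson 1976, §2, where both framings are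
used; Gompf 2010, §1). [cite: GompfStipsicz1999] -/
def IsCircleSurgery [T2Space X] (c : 𝕊 1 → X) : Prop :=
  ∃ ν : CircleNbhd IX c,
    IsOpenGluing IX (𝓘(ℝ, 𝔼 2).prod (𝓡 2)) IP (A := ν.complement) (B := ↥discTimesSphere)
      (P := P) (circleSurgeryRel ν)

end IsCircleSurgery

/-! ### Cappell–Shaneson spheres -/

section CappellShaneson

/-- **Cappell–Shaneson sphere of a matrix.** For `A ∈ SL(3, ℤ)` with `det (A - 1) = ±1`,
`IsCappellShanesonSphereOf A X` says that the 4-manifold `X` (charted on `𝔼 4`) is obtained as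
follows: take a smooth mapping torus `T` of the diffeomorphism `torusDiffeomorph A` of `T³` — a
closed smooth 4-manifold, glued from the cylinders `T³ × (0, 1)` and `T³ × (1/2, 3/2)` by open
embeddings `jA`, `jB` along `mappingTorusRel (torusDiffeomorph A)` — and do surgery
(`IsCircleSurgery`, either framing) on the *section circle* through the fixed point `1 ∈ T³`, i.e.
the smoothly embedded circle `c : 𝕊 1 → T` with image `jA ({1} × (0, 1)) ∪ jB ({1} × (1/2, 3/2))`.
Since `det (A - 1) = ±1`, `T` is a homology `𝕊 1 × 𝕊 3` and `X` is a homotopy 4-sphere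
(Cappell–Shaneson, *Some new four-manifolds*, Ann. of Math. 104 (1976), §2; Akbulut–Kirby 1985,
§1; Gompf 2010, §1). The explicit-witness form `IsOpenGluingWith` of the mapping torus is needed
only to *name* the section circle `jA '' ({1} ×ˢ univ) ∪ jB '' ({1} ×ˢ univ)`; see
`IsCappellShanesonSphereOf.exists_isMappingTorusOf` for the bridge to `IsMappingTorusOf`. The
predicate only needs `X` as a charted space; Hausdorffness, second countability, compactness and
smoothness of `X` are asserted where `X` is produced (`exists_isCappellShanesonSphereOf`). [cite: AkbulutKirby1985, §1] -/
def IsCappellShanesonSphereOf (A : Matrix.SpecialLinearGroup (Fin 3) ℤ) (X : Type*)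
    [TopologicalSpace X] [ChartedSpace (𝔼 4) X] : Prop :=
  ((A.1 - 1).det = 1 ∨ (A.1 - 1).det = -1) ∧
    ∃ (T : Type) (_ : TopologicalSpace T) (_ : T2Space T) (_ : SecondCountableTopology T)
      (_ : CompactSpace T) (_ : ChartedSpace (𝔼 4) T) (_ : IsManifold (𝓡 4) ∞ T)
      (jA : ThreeTorus × ↥mappingTorusPieceOne → T) (jB : ThreeTorus × ↥mappingTorusPieceTwo → T),
      IsOpenGluingWith (ModelWithCorners.prod 𝓣 𝓘(ℝ, ℝ))
          (ModelWithCorners.prod 𝓣 𝓘(ℝ, ℝ)) (𝓡 4)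
          (mappingTorusRel ⇑(torusDiffeomorph A)) jA jB ∧
        ∃ c : 𝕊 1 → T, Manifold.IsSmoothEmbedding (𝓡 1) (𝓡 4) ∞ c ∧
          Set.range c = jA '' ({1} ×ˢ Set.univ) ∪ jB '' ({1} ×ˢ Set.univ) ∧
          IsCircleSurgery (𝓡 4) (𝓡 4) T X c

/-- **Bridge to the accepted mapping torus predicate.** A Cappell–Shaneson sphere of `A` is
obtained by circle surgery on a smoothly embedded circle in *a* smooth mapping torus
(`IsMappingTorusOf`) of `torusDiffeomorph A` (forget the gluing witnesses via `isOpenGluing_iff`;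
Cappell–Shaneson 1976, §2; outline review #3). [cite: CappellShaneson1976, §2] -/
theorem IsCappellShanesonSphereOf.exists_isMappingTorusOf {A : Matrix.SpecialLinearGroup (Fin 3) ℤ}
    {X : Type*} [TopologicalSpace X] [ChartedSpace (𝔼 4) X]
    (h : IsCappellShanesonSphereOf A X) :
    ∃ (T : Type) (_ : TopologicalSpace T) (_ : T2Space T) (_ : SecondCountableTopology T)
      (_ : CompactSpace T) (_ : ChartedSpace (𝔼 4) T) (_ : IsManifold (𝓡 4) ∞ T),
      IsMappingTorusOf (𝓡 4) T (torusDiffeomorph A) ∧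
        ∃ c : 𝕊 1 → T, Manifold.IsSmoothEmbedding (𝓡 1) (𝓡 4) ∞ c ∧
          IsCircleSurgery (𝓡 4) (𝓡 4) T X c := by
  obtain ⟨-, T, _, _, _, _, _, _, jA, jB, hG, c, hc, -, hX⟩ := h
  refine ⟨T, ‹_›, ‹_›, ‹_›, ‹_›, ‹_›, ‹_›, ?_, c, hc, hX⟩
  exact hG.isOpenGluing

/-- The determinant condition of a Cappell–Shaneson matrix. [folklore] -/
theorem IsCappellShanesonSphereOf.det_sub_one {A : Matrix.SpecialLinearGroup (Fin 3) ℤ}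
    {X : Type*} [TopologicalSpace X] [ChartedSpace (𝔼 4) X]
    (h : IsCappellShanesonSphereOf A X) : (A.1 - 1).det = 1 ∨ (A.1 - 1).det = -1 :=
  h.1

/-- **Cappell–Shaneson sphere.** `X` is a Cappell–Shaneson (homotopy) 4-sphere: it is
`IsCappellShanesonSphereOf A X` for some `A ∈ SL(3, ℤ)` (with `det (A - 1) = ±1`)
(Cappell–Shaneson 1976, §2; Gompf 2010, §1). [cite: CappellShaneson1976, §2] -/
def IsCappellShanesonSphere (X : Type*) [TopologicalSpace X] [ChartedSpace (𝔼 4) X] : Prop :=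
  ∃ A : Matrix.SpecialLinearGroup (Fin 3) ℤ, IsCappellShanesonSphereOf A X

/-- The **Akbulut–Kirby matrix** `A₀ = !![0, 1, 0; 0, 1, 1; 1, 0, 1] ∈ SL(3, ℤ)`, the case `m = 0`
of the Cappell–Shaneson family, whose Cappell–Shaneson spheres were long-standing potential
counterexamples to the smooth 4-dimensional Poincaré conjecture (Akbulut–Kirby, Topology 24
(1985), §1; Gompf, Topology 30 (1991); Akbulut, Ann. of Math. 171 (2010)). [folklore] -/
def akbulutKirbyMatrix : Matrix.SpecialLinearGroup (Fin 3) ℤ :=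
  ⟨!![0, 1, 0; 0, 1, 1; 1, 0, 1], by decide⟩

/-- The **Cappell–Shaneson family** `Aₘ = !![0, 1, 0; 0, 1, 1; 1, 0, m + 1] ∈ SL(3, ℤ)`, `m ∈ ℤ`;
every `A ∈ SL(3, ℤ)` with `det (A - 1) = 1` is conjugate to some `Aₘ` up to finitely many further
families (Cappell–Shaneson 1976, §2; Akbulut–Kirby 1985, §1; Gompf, Algebr. Geom. Topol. 10 (2010),
§1). [cite: CappellShaneson1976, §2] -/
def cappellShanesonMatrix (m : ℤ) : Matrix.SpecialLinearGroup (Fin 3) ℤ :=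
  ⟨!![0, 1, 0; 0, 1, 1; 1, 0, m + 1], by simp [Matrix.det_fin_three]⟩

/-- The underlying matrix of `akbulutKirbyMatrix`. [folklore] -/
@[simp] theorem coe_akbulutKirbyMatrix :
    (akbulutKirbyMatrix : Matrix (Fin 3) (Fin 3) ℤ) = !![0, 1, 0; 0, 1, 1; 1, 0, 1] := rfl

/-- The underlying matrix of `cappellShanesonMatrix m`. [folklore] -/
@[simp] theorem coe_cappellShanesonMatrix (m : ℤ) :
    (cappellShanesonMatrix m : Matrix (Fin 3) (Fin 3) ℤ) = !![0, 1, 0; 0, 1, 1; 1, 0, m + 1] :=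
  rfl

/-- `det (A₀ - 1) = 1` for the Akbulut–Kirby matrix, so its mapping torus is a homology
`𝕊 1 × 𝕊 3` (Akbulut–Kirby 1985, §1). [cite: AkbulutKirby1985, §1] -/
theorem det_akbulutKirbyMatrix_sub_one : (akbulutKirbyMatrix.1 - 1).det = 1 := by
  decide

/-- `det (Aₘ - 1) = 1` for every member of the Cappell–Shaneson family
(Cappell–Shaneson 1976, §2). [cite: CappellShaneson1976, §2] -/
theorem det_cappellShanesonMatrix_sub_one (m : ℤ) : ((cappellShanesonMatrix m).1 - 1).det = 1 := by
  simp [cappellShanesonMatrix, Matrix.det_fin_three, Matrix.one_fin_three]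

/-- The Akbulut–Kirby matrix is the member `m = 0` of the Cappell–Shaneson family
(Akbulut–Kirby 1985, §1). [cite: AkbulutKirby1985, §1] -/
@[simp] theorem cappellShanesonMatrix_zero : cappellShanesonMatrix 0 = akbulutKirbyMatrix :=
  Subtype.ext (by simp)

end CappellShaneson

/-! ### Existence and uniqueness (sorried, known results) -/

section Existence

universe u

/-- **Tubular neighbourhoods of circles in orientable manifolds.** A smoothly embedded circle in
an orientable smooth 4-manifold has an open tubular neighbourhood `𝕊 1 × ℝ³ ↪ X`: by the tubular
neighbourhood theorem it has one modelled on its normal bundle, an orientable rank-`3` bundle over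
`𝕊 1`, hence trivial (`SO(3)` is connected). Orientability cannot be dropped: an
orientation-reversing loop in a non-orientable manifold has non-trivial normal bundle
(Kosinski, *Differential Manifolds*, IV.5; Gompf–Stipsicz (1999), §4.6, §5.2). [cite: GompfStipsicz1999] -/
def nonempty_circleNbhd : Prop :=
  ∀ {X : Type u} [TopologicalSpace X] [T2Space X] [SecondCountableTopology X] [ChartedSpace (𝔼 4) X] [IsManifold (𝓡 4) ∞ X] (hX : IsOrientable (𝓡 4) X) (c : 𝕊 1 → X) (hc : Manifold.IsSmoothEmbedding (𝓡 1) (𝓡 4) ∞ c),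
    Nonempty (CircleNbhd (𝓡 4) c)

/-- **Existence of circle surgery.** A smoothly embedded circle `c` in a closed (compact,
Hausdorff, second countable) orientable smooth 4-manifold `X` admits a surgery: there is a closed
smooth 4-manifold `P` with `IsCircleSurgery (𝓡 4) (𝓡 4) X P c`. Choose a tubular neighbourhood
`ν` (`nonempty_circleNbhd`; this is where orientability is used — without it the normal bundle of
`c` may be non-trivial and no surgery in the present sense exists) and form the pushout of
`X ∖ c(𝕊 1)` and `D̊² × 𝕊 2` along `circleSurgeryRel ν`; it is Hausdorff since the core circle and
the core sphere are removed from the overlap, and compact as the union of the compact sets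
`X ∖ ν(𝕊 1 × B³_{1/2})` and `D²_{1/2} × 𝕊 2` (Kosinski, *Differential Manifolds*, VI.1–2;
Gompf–Stipsicz (1999), §5.2; Cappell–Shaneson 1976, §2). [cite: GompfStipsicz1999] -/
def exists_isCircleSurgery : Prop :=
  ∀ {X : Type u} [TopologicalSpace X] [T2Space X] [SecondCountableTopology X] [CompactSpace X] [ChartedSpace (𝔼 4) X] [IsManifold (𝓡 4) ∞ X] (hX : IsOrientable (𝓡 4) X) (c : 𝕊 1 → X) (hc : Manifold.IsSmoothEmbedding (𝓡 1) (𝓡 4) ∞ c),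
    ∃ (P : Type u) (_ : TopologicalSpace P) (_ : T2Space P) (_ : SecondCountableTopology P)
      (_ : ChartedSpace (𝔼 4) P) (_ : IsManifold (𝓡 4) ∞ P) (_ : CompactSpace P),
      IsCircleSurgery (𝓡 4) (𝓡 4) X P c

/-- **Uniqueness of circle surgery for a fixed tubular neighbourhood.** Two open gluings of
`X ∖ c(𝕊 1)` and `D̊² × 𝕊 2` along the *same* relation `circleSurgeryRel ν` are diffeomorphic: an
open gluing is determined up to diffeomorphism by its pieces and relation (Kosinski, *Differential
Manifolds*, VI.1; Gompf–Stipsicz (1999), §5.2). (For different `ν` the results may differ, by the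
framing in `π₁ SO(3) = ℤ/2`.) [cite: GompfStipsicz1999] -/
def nonempty_diffeomorph_of_isCircleSurgery_of_eq : Prop :=
  ∀ {EX HX : Type*} [NormedAddCommGroup EX] [NormedSpace ℝ EX] [TopologicalSpace HX] {IX : ModelWithCorners ℝ EX HX} {X : Type*} [TopologicalSpace X] [T2Space X] [ChartedSpace HX X] [IsManifold IX ∞ X] {EP HP : Type*} [NormedAddCommGroup EP] [NormedSpace ℝ EP] [FiniteDimensional ℝ EP] [TopologicalSpace HP] {IP : ModelWithCorners ℝ EP HP} {P : Type*} [TopologicalSpace P] [ChartedSpace HP P] [IsManifold IP ∞ P] {HP' : Type*} [TopologicalSpace HP'] {IP' : ModelWithCorners ℝ EP HP'} {P' : Type*} [TopologicalSpace P'] [ChartedSpace HP' P'] [IsManifold IP' ∞ P'] {c : 𝕊 1 → X} (ν : CircleNbhd IX c) (h : IsOpenGluing IX (𝓘(ℝ, 𝔼 2).prod (𝓡 2)) IP (A := ν.complement) (B := ↥discTimesSphere) (P := P) (circleSurgeryRel ν)) (h' : IsOpenGluing IX (𝓘(ℝ, 𝔼 2).prod (𝓡 2)) IP' (A := ν.complement)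 (B := ↥discTimesSphere) (P := P') (circleSurgeryRel ν)),
    Nonempty (P ≃ₘ⟮IP, IP'⟯ P')

/-- **Existence of Cappell–Shaneson spheres.** For every `A ∈ SL(3, ℤ)` with `det (A - 1) = ±1`
there is a closed smooth 4-manifold `X` with `IsCappellShanesonSphereOf A X`: form the mapping
torus of `torusDiffeomorph A` (`exists_isMappingTorusOf`, transported to the model `𝓣.prod 𝓘(ℝ, ℝ)`
of the cylinders), observe that the section through the fixed point `1` is a smoothly embedded
circle with trivial normal bundle (the mapping torus of `T_1 T³` under `dA`, an orientable bundle
over `𝕊 1`), and do surgery on it (`exists_isCircleSurgery`) (Cappell–Shaneson, *Some new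
four-manifolds*, Ann. of Math. 104 (1976), §2). [cite: CappellShaneson1976, §2 (construction of the Cappell–Shaneson spheres)] -/
def exists_isCappellShanesonSphereOf : Prop :=
  ∀ (A : Matrix.SpecialLinearGroup (Fin 3) ℤ) (hA : (A.1 - 1).det = 1 ∨ (A.1 - 1).det = -1),
    ∃ (X : Type) (_ : TopologicalSpace X) (_ : T2Space X) (_ : SecondCountableTopology X)
      (_ : ChartedSpace (𝔼 4) X) (_ : IsManifold (𝓡 4) ∞ X) (_ : CompactSpace X),
      IsCappellShanesonSphereOf A X

/-- The Akbulut–Kirby matrix has a Cappell–Shaneson sphere (Akbulut–Kirby 1985, §1). [cite: AkbulutKirby1985, §1] -/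
def exists_isCappellShanesonSphereOf_akbulutKirbyMatrix : Prop :=
  ∃ (X : Type) (_ : TopologicalSpace X) (_ : T2Space X) (_ : SecondCountableTopology X)
      (_ : ChartedSpace (𝔼 4) X) (_ : IsManifold (𝓡 4) ∞ X) (_ : CompactSpace X),
      IsCappellShanesonSphereOf akbulutKirbyMatrix X

/- interim proof relied on results that are now named facts (D-0014); demoted to a fact by the M5 import, proof preserved:
:=
  exists_isCappellShanesonSphereOf _ (Or.inl det_akbulutKirbyMatrix_sub_one)
-/

end Existence

end Literature.Topology.FourManifolds
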